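import Summits.ValiantsHypothesis.ValiantsHypothesis.Theorems.LacunarySymmetroidMatrixDescartesDoorA26WallBubblingPureDSieve

/-!
# Wall bubbling for `DoorA26` — (W) first rung: the WEYL FIRST-ORDER ANATOMY (the degenerate stratum at a generic Weyl face)

HONEST FRAMING.  Rung file for obligation (W) `stub_weylFaces` of the line `Cruxes/DoorA26/Lines/wall_bubbling.lean`
(stmt-ValiantsHypothesis-19979 `DoorA26`; OPEN, typed, never asserted), re-pointed seat val-sym-door-p1 g13 (W2, desk R2664 /
director R260).  (W) says that twenties do not accumulate at Weyl faces `δᵢ = δⱼ` of the exponent simplex.  By the landed reduction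
(B) (`…WallBubblingBubblingAssembly.stub_bubbling_proof`) accumulation at a coincidence point leaves a nonzero REALISABLE BLOW-UP PATTERN
`G` (a `±` Gram matrix of six symmetric `2 × 2` letters for the polar form of `det`, all pair-sum value classes summing to zero).  At a
Weyl face the first-order sieve PASSES (such patterns exist), so (W) is a second-order statement; this file supplies its FIRST RUNG —
what a first-order Weyl pattern forces on the letters:

* `weylPattern_of_blockSumsZero` — at an exponent vector whose ONLY coincidence among distinct letters is `δ i = δ j` (no mixed
  `2δ_a = δ_k + δ_l`, no disjoint `δ_a + δ_b = δ_k + δ_l` among distinct letters), `BlockSumsZero` for a symmetric `G` is EXACTLY the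
  pattern: `G k l = 0` off the rows/columns `i, j`; `G i k + G j k = 0` (`k ∉ {i,j}`); `G i i + 2 G i j + G j j = 0`;
* `weylAnatomy_of_pattern` — if such a pattern is realised by letters `S` (`G a b = ε·polar(S a, S b)`, `ε = ±1`), then every other letter
  `S k` (`k ∉ {i,j}`) is `det`-NULL, the other letters are pairwise PARALLEL, `S i + S j` is NULL and parallel to them: the letters lie on
  the stratum `{S k ∈ ℝ·N (k ∉ {i,j}), S i + S j ∈ ℝ·N}` for one rank-one `N` — the limit pencil is `φ(x)·N` with `det ≡ 0`
  (pure blow-up), and the second-order analysis of (W) is a LOCAL statement at this explicit stratum (analogue of the card's (M) anatomy);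
* `weylAnatomy` — the two combined, in the line's inlined-definition shape.

Generic Weyl face only (one coincidence); the non-generic faces (several coincidences) are not treated here.  Pure linear algebra of the
polar form on `Sym₂(ℝ) ≅ ℝ^{1,2}` (the null cone contains no two `det`-orthogonal non-parallel vectors — tree lemma
`exists_smul_of_polar_eq_zero`); no new definitions; (W) stays OPEN; nothing here bears on `DoorA26`, `MatrixDescartes`
(stmt-ValiantsHypothesis-18050) or `VP ≠ VNP`.

[folklore] Elementary linear algebra; bookkeeping of pair-sum value classes.
-/

-- `Summit.ValiantsHypothesis.ValiantsHypothesis.…` repeats a component by the D-0017 layout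
-- (single-conjunct summit), which the `dupNamespace` linter flags; the name is mandated.
set_option linter.dupNamespace false

namespace Summit.ValiantsHypothesis.ValiantsHypothesis.Theorems.LacunarySymmetroidMatrixDescartes.WallBubbling

open Finset Matrix
open scoped BigOperators

/-! ## Bilinearity of the polar form -/

/-- The polar form is additive in its first argument. [folklore] -/
theorem polar_add_left (A B C : Matrix (Fin 2) (Fin 2) ℝ) :
    ((A + B + C).det - (A + B).det - C.det) / 2
      = ((A + C).det - A.det - C.det) / 2 + ((B + C).det - B.det - C.det) / 2 := by
  simp only [Matrix.det_fin_two, Matrix.add_apply]; ring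

/-- `det(A + B) = det A + det B + 2·polar(A, B)`. [folklore] -/
theorem det_add_eq_polar (A B : Matrix (Fin 2) (Fin 2) ℝ) :
    (A + B).det = A.det + B.det + 2 * (((A + B).det - A.det - B.det) / 2) := by ring

/-! ## The letter-level anatomy of a realised Weyl pattern -/

/-- **WEYL FIRST-ORDER ANATOMY.**  Let `G = ε·(polar(S a, S b))` (`ε = ±1`, symmetric letters) satisfy the first-order Weyl pattern at
the pair `{i, j}`: `G k l = 0` for `k, l ∉ {i,j}`, `G i k + G j k = 0` for `k ∉ {i,j}`, `G i i + 2 G i j + G j j = 0`.  Then the four other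
letters are `det`-null and pairwise parallel, `S i + S j` is `det`-null and `det`-orthogonal — hence parallel — to every non-zero other letter.
[folklore] -/
theorem weylAnatomy_of_pattern (i j : Fin 6) (G : Matrix (Fin 6) (Fin 6) ℝ)
    (ε : ℝ) (S : Fin 6 → Matrix (Fin 2) (Fin 2) ℝ) (hε : ε = 1 ∨ ε = -1) (hS : ∀ l, (S l).IsSymm)
    (hG : ∀ a b, G a b = ε * (((S a + S b).det - (S a).det - (S b).det) / 2))
    (h0 : ∀ k l, k ≠ i → k ≠ j → l ≠ i → l ≠ j → G k l = 0)
    (h1 : ∀ k, k ≠ i → k ≠ j → G i k + G j k = 0)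
    (h2 : G i i + 2 * G i j + G j j = 0) :
    (∀ k, k ≠ i → k ≠ j → (S k).det = 0) ∧
    (S i + S j).det = 0 ∧
    (∀ k, k ≠ i → k ≠ j → ((S i + S j + S k).det - (S i + S j).det - (S k).det) / 2 = 0) ∧
    (∀ k l, k ≠ i → k ≠ j → l ≠ i → l ≠ j → S k ≠ 0 → ∃ c : ℝ, S l = c • S k) ∧
    (∀ k, k ≠ i → k ≠ j → S k ≠ 0 → ∃ c : ℝ, S i + S j = c • S k) := by
  have hε0 : ε ≠ 0 := by rcases hε with rfl | rfl <;> norm_num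
  -- polar values vanish where `G` does
  have hpol : ∀ a b, G a b = 0 → ((S a + S b).det - (S a).det - (S b).det) / 2 = 0 := by
    intro a b h
    rw [hG] at h
    rcases mul_eq_zero.mp h with h' | h'
    · exact absurd h' hε0
    · exact h'
  -- (1) the other letters are null
  have hnull : ∀ k, k ≠ i → k ≠ j → (S k).det = 0 := by
    intro k hki hkj
    have h := hpol k k (h0 k k hki hkj hki hkj)
    rwa [polar_self] at h
  -- (2) `S i + S j` is null
  have hsum_null : (S i + S j).det = 0 := by
    have e : G i i + 2 * G i j + G j j = ε * (S i + S j).det := by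
      rw [hG i i, hG i j, hG j j, polar_self, polar_self, det_add_eq_polar (S i) (S j)]; ring
    rw [e] at h2
    rcases mul_eq_zero.mp h2 with h' | h'
    · exact absurd h' hε0
    · exact h'
  -- (3) `S i + S j ⟂ S k`
  have horth : ∀ k, k ≠ i → k ≠ j → ((S i + S j + S k).det - (S i + S j).det - (S k).det) / 2 = 0 := by
    intro k hki hkj
    have h := h1 k hki hkj
    rw [hG i k, hG j k, ← mul_add, ← polar_add_left] at h
    rcases mul_eq_zero.mp h with h' | h'
    · exact absurd h' hε0
    · exact h'
  refine ⟨hnull, hsum_null, horth, ?_, ?_⟩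
  · -- (4) the other letters are pairwise parallel
    intro k l hki hkj hli hlj hk0
    by_cases hkl : l = k
    · subst hkl; exact ⟨1, by simp⟩
    have h := hpol l k (h0 l k hli hlj hki hkj)
    exact exists_smul_of_polar_eq_zero (hS l) (hS k) (hnull l hli hlj) (hnull k hki hkj) hk0 h
  · -- (5) `S i + S j` parallel to every nonzero other letter
    intro k hki hkj hk0
    have hsymm : (S i + S j).IsSymm := (hS i).add (hS j)
    exact exists_smul_of_polar_eq_zero hsymm (hS k) hsum_null (hnull k hki hkj) hk0 (horth k hki hkj)

/-! ## Value classes at a generic Weyl face -/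

/-- KEY LEMMA.  If no mixed coincidence `2δ_a = δ_k + δ_l` and no disjoint coincidence `δ_a + δ_b = δ_k + δ_l` holds among
DISTINCT letters, then two pair sums agree only when the two pairs carry the same VALUES. [folklore] -/
theorem pairSum_eq_imp {δ : Fin 6 → ℝ}
    (hM : ∀ a k l : Fin 6, a ≠ k → a ≠ l → k ≠ l → 2 * δ a ≠ δ k + δ l)
    (hD : ∀ a b k l : Fin 6, a ≠ b → a ≠ k → a ≠ l → b ≠ k → b ≠ l → k ≠ l → δ a + δ b ≠ δ k + δ l)
    {a b k l : Fin 6} (h : δ a + δ b = δ k + δ l) :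
    (δ a = δ k ∧ δ b = δ l) ∨ (δ a = δ l ∧ δ b = δ k) := by
  by_cases hak : δ a = δ k
  · exact Or.inl ⟨hak, by linarith⟩
  by_cases hal : δ a = δ l
  · exact Or.inr ⟨hal, by linarith⟩
  exfalso
  have hbl : δ b ≠ δ l := fun h' => hak (by linarith)
  have hbk : δ b ≠ δ k := fun h' => hal (by linarith)
  have nak : a ≠ k := fun h' => hak (by rw [h'])
  have nal : a ≠ l := fun h' => hal (by rw [h'])
  have nbk : b ≠ k := fun h' => hbk (by rw [h'])
  have nbl : b ≠ l := fun h' => hbl (by rw [h'])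
  by_cases hab : δ a = δ b
  · have hkl : k ≠ l := by
      intro h'; subst h'; apply hak; linarith
    exact hM a k l nak nal hkl (by linarith)
  · have nab : a ≠ b := fun h' => hab (by rw [h'])
    by_cases hkl : δ k = δ l
    · exact hM k a b (fun h' => nak h'.symm) (fun h' => nbk h'.symm) nab (by linarith)
    · have nkl : k ≠ l := fun h' => hkl (by rw [h'])
      exact hD a b k l nab nak nal nbk nbl nkl h

/-- The double `if`-sum of `BlockSumsZero` as a sum over the filtered product. [folklore] -/
theorem blockSum_eq_sum_filter (δ : Fin 6 → ℝ) (G : Matrix (Fin 6) (Fin 6) ℝ) (v : ℝ) :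
    (∑ a, ∑ b, if δ a + δ b = v then G a b else 0)
      = ∑ p ∈ (Finset.univ : Finset (Fin 6 × Fin 6)).filter (fun p => δ p.1 + δ p.2 = v), G p.1 p.2 := by
  rw [Finset.sum_filter, ← Finset.univ_product_univ, Finset.sum_product]

/-- **THE WEYL PATTERN.**  Let `δ i = δ j` (`i ≠ j`) be the ONLY coincidence: every equality `δ k = δ l` of letters is trivial or `{k,l} = {i,j}`,
and there is no mixed and no disjoint coincidence among distinct letters.  If all pair-sum value classes of a symmetric `G` sum to zero, then
`G` has the first-order Weyl pattern: zero off the rows/columns `i, j`, `G i k + G j k = 0` for `k ∉ {i,j}`, `G i i + 2 G i j + G j j = 0`.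
[folklore] -/
theorem weylPattern_of_blockSumsZero (δ : Fin 6 → ℝ) (i j : Fin 6) (hij : i ≠ j) (hδ : δ i = δ j)
    (hW : ∀ k l : Fin 6, δ k = δ l → k = l ∨ (k = i ∧ l = j) ∨ (k = j ∧ l = i))
    (hM : ∀ a k l : Fin 6, a ≠ k → a ≠ l → k ≠ l → 2 * δ a ≠ δ k + δ l)
    (hD : ∀ a b k l : Fin 6, a ≠ b → a ≠ k → a ≠ l → b ≠ k → b ≠ l → k ≠ l → δ a + δ b ≠ δ k + δ l)
    (G : Matrix (Fin 6) (Fin 6) ℝ) (hGs : ∀ a b, G a b = G b a)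
    (hB : ∀ v : ℝ, (∑ a, ∑ b, if δ a + δ b = v then G a b else 0) = 0) :
    (∀ k l, k ≠ i → k ≠ j → l ≠ i → l ≠ j → G k l = 0) ∧
    (∀ k, k ≠ i → k ≠ j → G i k + G j k = 0) ∧
    (G i i + 2 * G i j + G j j = 0) := by
  classical
  -- values ↔ letters
  have hvk : ∀ k, k ≠ i → k ≠ j → ∀ a, δ a = δ k ↔ a = k := by
    intro k hki hkj a
    constructor
    · intro h
      rcases hW a k h with h' | ⟨-, h'⟩ | ⟨-, h'⟩
      · exact h'
      · exact absurd h' hkj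
      · exact absurd h' hki
    · intro h; rw [h]
  have hvi : ∀ a, δ a = δ i ↔ (a = i ∨ a = j) := by
    intro a
    constructor
    · intro h
      rcases hW a i h with h' | ⟨h', -⟩ | ⟨h', -⟩
      · exact Or.inl h'
      · exact Or.inl h'
      · exact Or.inr h'
    · rintro (h | h)
      · rw [h]
      · rw [h, hδ]
  have key := fun {a b k l : Fin 6} (h : δ a + δ b = δ k + δ l) => pairSum_eq_imp hM hD h
  -- the class sums as sums over explicit finsets
  have hcls : ∀ (v : ℝ) (E : Finset (Fin 6 × Fin 6)),
      (∀ p : Fin 6 × Fin 6, δ p.1 + δ p.2 = v ↔ p ∈ E) → ∑ p ∈ E, G p.1 p.2 = 0 := by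
    intro v E hE
    have h := hB v
    rw [blockSum_eq_sum_filter] at h
    have hset : (Finset.univ : Finset (Fin 6 × Fin 6)).filter (fun p => δ p.1 + δ p.2 = v) = E := by
      ext p
      simp only [Finset.mem_filter, Finset.mem_univ, true_and]
      exact hE p
    rwa [hset] at h
  refine ⟨?_, ?_, ?_⟩
  · -- off the rows/columns i, j
    intro k l hki hkj hli hlj
    by_cases hkl : k = l
    · subst hkl
      have h := hcls (δ k + δ k) {(k, k)} (by
        intro p
        rw [Finset.mem_singleton]
        constructor
        · intro h
          rcases key h with ⟨h1, h2⟩ | ⟨h1, h2⟩ <;>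
          · rw [hvk k hki hkj] at h1 h2
            exact Prod.ext h1 h2
        · intro h; rw [h])
      simpa using h
    · have h := hcls (δ k + δ l) {(k, l), (l, k)} (by
        intro p
        rw [Finset.mem_insert, Finset.mem_singleton]
        constructor
        · intro h
          rcases key h with ⟨h1, h2⟩ | ⟨h1, h2⟩
          · rw [hvk k hki hkj] at h1; rw [hvk l hli hlj] at h2
            exact Or.inl (Prod.ext h1 h2)
          · rw [hvk l hli hlj] at h1; rw [hvk k hki hkj] at h2
            exact Or.inr (Prod.ext h1 h2)
        · rintro (h | h) <;> rw [h]
          rw [add_comm])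
      have n3 : ((k, l) : Fin 6 × Fin 6) ≠ (l, k) := fun h => hkl (Prod.mk.inj h).1
      rw [Finset.sum_pair n3] at h
      simp only at h
      rw [hGs l k] at h
      linarith
  · -- the merged classes {(i,k),(j,k)}
    intro k hki hkj
    have h := hcls (δ i + δ k) {(i, k), (j, k), (k, i), (k, j)} (by
      intro p
      simp only [Finset.mem_insert, Finset.mem_singleton]
      constructor
      · intro h
        rcases key h with ⟨h1, h2⟩ | ⟨h1, h2⟩
        · rw [hvi] at h1; rw [hvk k hki hkj] at h2
          rcases h1 with h1 | h1
          · exact Or.inl (Prod.ext h1 h2)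
          · exact Or.inr (Or.inl (Prod.ext h1 h2))
        · rw [hvk k hki hkj] at h1; rw [hvi] at h2
          rcases h2 with h2 | h2
          · exact Or.inr (Or.inr (Or.inl (Prod.ext h1 h2)))
          · exact Or.inr (Or.inr (Or.inr (Prod.ext h1 h2)))
      · rintro (h | h | h | h) <;> rw [h] <;> simp only [hδ, add_comm])
    have n1 : (i, k) ∉ ({(j, k), (k, i), (k, j)} : Finset (Fin 6 × Fin 6)) := by
      simp only [Finset.mem_insert, Finset.mem_singleton, Prod.mk.injEq, not_or]
      exact ⟨fun h => hij h.1, fun h => hki h.1.symm, fun h => hki h.1.symm⟩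
    have n2 : (j, k) ∉ ({(k, i), (k, j)} : Finset (Fin 6 × Fin 6)) := by
      simp only [Finset.mem_insert, Finset.mem_singleton, Prod.mk.injEq, not_or]
      exact ⟨fun h => hkj h.1.symm, fun h => hkj h.1.symm⟩
    have n3 : ((k, i) : Fin 6 × Fin 6) ≠ (k, j) := fun h => hij (Prod.mk.inj h).2
    rw [Finset.sum_insert n1, Finset.sum_insert n2, Finset.sum_pair n3] at h
    simp only at h
    rw [hGs k i, hGs k j] at h
    linarith
  · -- the triple class {(i,i),(i,j),(j,j)}
    have h := hcls (δ i + δ i) {(i, i), (i, j), (j, i), (j, j)} (by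
      intro p
      simp only [Finset.mem_insert, Finset.mem_singleton]
      constructor
      · intro h
        rcases key h with ⟨h1, h2⟩ | ⟨h1, h2⟩ <;>
        · rw [hvi] at h1 h2
          rcases h1 with h1 | h1 <;> rcases h2 with h2 | h2
          · exact Or.inl (Prod.ext h1 h2)
          · exact Or.inr (Or.inl (Prod.ext h1 h2))
          · exact Or.inr (Or.inr (Or.inl (Prod.ext h1 h2)))
          · exact Or.inr (Or.inr (Or.inr (Prod.ext h1 h2)))
      · rintro (h | h | h | h) <;> rw [h] <;> simp only [hδ])
    have n1 : (i, i) ∉ ({(i, j), (j, i), (j, j)} : Finset (Fin 6 × Fin 6)) := by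
      simp only [Finset.mem_insert, Finset.mem_singleton, Prod.mk.injEq, not_or]
      exact ⟨fun h => hij h.2, fun h => hij h.1, fun h => hij h.1⟩
    have n2 : (i, j) ∉ ({(j, i), (j, j)} : Finset (Fin 6 × Fin 6)) := by
      simp only [Finset.mem_insert, Finset.mem_singleton, Prod.mk.injEq, not_or]
      exact ⟨fun h => hij h.1, fun h => hij h.1⟩
    have n3 : ((j, i) : Fin 6 × Fin 6) ≠ (j, j) := fun h => hij (Prod.mk.inj h).2
    rw [Finset.sum_insert n1, Finset.sum_insert n2, Finset.sum_pair n3] at h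
    simp only at h
    rw [hGs j i] at h
    linarith

/-- **WEYL FIRST-ORDER ANATOMY at a generic Weyl face** — `weylPattern_of_blockSumsZero` followed by `weylAnatomy_of_pattern`, in the
line's inlined-definition shape: a realisable blow-up pattern (`BlockSumsZero` + `Realisable`, definitions of
`Cruxes/DoorA26/Lines/wall_bubbling.lean` inlined) at an exponent vector whose only coincidence is `δ i = δ j` lives, for every
realisation, on the stratum «other letters null and pairwise parallel, `S i + S j` null and parallel to them». [folklore] -/
theorem weylAnatomy (δ : Fin 6 → ℝ) (i j : Fin 6) (hij : i ≠ j) (hδ : δ i = δ j)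
    (hW : ∀ k l : Fin 6, δ k = δ l → k = l ∨ (k = i ∧ l = j) ∨ (k = j ∧ l = i))
    (hM : ∀ a k l : Fin 6, a ≠ k → a ≠ l → k ≠ l → 2 * δ a ≠ δ k + δ l)
    (hD : ∀ a b k l : Fin 6, a ≠ b → a ≠ k → a ≠ l → b ≠ k → b ≠ l → k ≠ l → δ a + δ b ≠ δ k + δ l)
    (G : Matrix (Fin 6) (Fin 6) ℝ)
    (hB : ∀ v : ℝ, (∑ a, ∑ b, if δ a + δ b = v then G a b else 0) = 0)
    (ε : ℝ) (S : Fin 6 → Matrix (Fin 2) (Fin 2) ℝ) (hε : ε = 1 ∨ ε = -1) (hS : ∀ l, (S l).IsSymm)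
    (hG : ∀ a b, G a b = ε * (((S a + S b).det - (S a).det - (S b).det) / 2)) :
    (∀ k, k ≠ i → k ≠ j → (S k).det = 0) ∧
    (S i + S j).det = 0 ∧
    (∀ k, k ≠ i → k ≠ j → ((S i + S j + S k).det - (S i + S j).det - (S k).det) / 2 = 0) ∧
    (∀ k l, k ≠ i → k ≠ j → l ≠ i → l ≠ j → S k ≠ 0 → ∃ c : ℝ, S l = c • S k) ∧
    (∀ k, k ≠ i → k ≠ j → S k ≠ 0 → ∃ c : ℝ, S i + S j = c • S k) := by
  have hGs : ∀ a b, G a b = G b a := fun a b => by rw [hG, hG b a, polar_comm]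
  obtain ⟨h0, h1, h2⟩ := weylPattern_of_blockSumsZero δ i j hij hδ hW hM hD G hGs hB
  exact weylAnatomy_of_pattern i j G ε S hε hS hG h0 h1 h2

end Summit.ValiantsHypothesis.ValiantsHypothesis.Theorems.LacunarySymmetroidMatrixDescartes.WallBubbling
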